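import Summits.ResolutionOfSingularities.ResolutionOfSingularities.Theorems.ThreadCutLaw2
import Summits.ResolutionOfSingularities.ResolutionOfSingularities.Theorems.DeltaCutRun2
import HarnessLib

/-!
# ThreadCutJunction — decomp-res node «ThreadCut» (lens-5 g31, critic row 198 CLEARED +1), tree file 4/4 of the node

Content VERBATIM from the decomp-res lens-5 g31 node `HOME/decomp-res-lens-5/g31/ThreadCut.lean` (pin 856c26bf; no
carry, imports the landed tree only); HOME = run/shared/lean/pub/decomp-res; critic row 198 CLEARED +1; landing plan
NODE-g31.md 442a09ac §7 + rider INBOX :1203 — provenance, critic text and the lens header in full in the first file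
of the node, `ThreadCutLaw`.  Namespace `…Theorems.ThreadCut`; `--supports stmt-ResolutionOfSingularities-31770`
unless said otherwise.

## This file

§7 THE EXACT HYPOTHESIS-FREE DICHOTOMY OF LENS-6's PERPETUAL KIND by the scheme shadow of axiality (node l. 847–917;
lens-6's `BadThread`, `run`, `WORTopRunPerpetual n` binders BY NAME and VERBATIM): `EventuallyNonIsolated (T :
BadThread n N)`, `RunThreadsNonIsolated`, the two CELLS `WORTopRunPerpetualNonIso n` [RESIDUAL · P∞'s side, model
certificate §6] / `WORTopRunPerpetualIso n` [RESIDUAL · the habitat of lens-4 / lens-5's columns], the carve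
`worTopRunPerpetual_iff_nonIso_iso`, the `E 1` aggregates `E1TopRunPerpetualNonIso` / `E1TopRunPerpetualIso`
[RESIDUAL] and `node_equation : E1TopRunPerpetual ↔ E1TopRunPerpetualNonIso ∧ E1TopRunPerpetualIso`.  This file
`--supports stmt-ResolutionOfSingularities-26971` (lens-6 column; the rest of the node supports 31770); no aside
switch, no item (critic rider).

[WRITER NOTE (decomp-res writer g12): file split only (tree files ≤ 400 lines); namespace, sections, section
variables / opens and every declaration exactly as in the lens (the node's HOME-only dupNamespace-linter line is
dropped; the namespace-level `open` lines of the node are replayed in every part); in `ThreadCutJunction` the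
docstrings of the two §7 cells `WORTopRunPerpetualNonIso` / `WORTopRunPerpetualIso` gain the word RESIDUAL (critic
rider row 198, cn26) — statements untouched.]

(Sources: Hauser2010 §§F–G (kangaroo points, corner calculus); HauserPerlega2019 §2; Hironaka1967;
CossartJannsenSaito2020 Ch. 8; CossartPiltant2008 §2; CornerTowerDescent (lens-5 g13, tree); DeltaCutRun2 (lens-6 g25, tree).)
-/

open MvPolynomial
open Literature.AlgebraicGeometry.Resolution
open Literature.AlgebraicGeometry.Resolution.Hauser2010
open Literature.AlgebraicGeometry.Resolution.PointBlowup
open Summit.ResolutionOfSingularities.ResolutionOfSingularities.Theorems.TightDefectClasses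
open Summit.ResolutionOfSingularities.ResolutionOfSingularities.Theorems.CornerTowerDescent
open Summit.ResolutionOfSingularities.ResolutionOfSingularities.Theorems.LassoCut

namespace Summit.ResolutionOfSingularities.ResolutionOfSingularities.Theorems.ThreadCut

section Junction

open CategoryTheory AlgebraicGeometry TopologicalSpace
open Summit.ResolutionOfSingularities.ResolutionOfSingularities.Theorems
open WeakOrderReduction ForcedTowerClasses DeltaCutClasses TwistCutClasses LightCutClasses

/-! ## §7 THE EXACT DICHOTOMY OF LENS-6's PERPETUAL KIND by the scheme shadow of axiality (lens-6's names BY NAME) -/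

/-- A bad thread of lens-6's run is EVENTUALLY NON-ISOLATED: from some level on its point is not isolated in the top
locus `{ord ≥ n}` of its level — the scheme shadow of an (eventually) AXIAL / CRUCIFORM thread of the model (§4: a top
line passes through the point).  DEFINITION (thread kind; over lens-6's `BadThread`, `run` BY NAME). -/
def EventuallyNonIsolated {n : ℕ} {N : Stage} (T : BadThread n N) : Prop :=
  ∃ i₀ : ℕ, ∀ i, i₀ ≤ i →
    ¬ IsIsolatedIn {y : ↥(run n N i).Y | ((n : ℕ) : ℕ∞) ≤ idealOrder (run n N i).I y} (T.pt i)

/-- The run's threads are ALL eventually non-isolated (P∞: every bad point of every level is the crossing of the two top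
lines `L_s~`, `L_w~`).  DEFINITION (datum kind). -/
def RunThreadsNonIsolated (n : ℕ) (N : Stage) : Prop :=
  ∀ T : BadThread n N, EventuallyNonIsolated T

/-- CELL · RESIDUAL · the NON-ISOLATED (axial-type) perpetual kind — lens-6's `WORTopRunPerpetual n` binders
VERBATIM plus «every bad
thread eventually non-isolated».  [P∞'s side (model certificate §6) · OPEN qua resolution statement (lens-6's column) ·
BRIDGE by name: such thread points lie on positive-dimensional top components = inside the strict transform of the old
top locus that `sepHop` blows up second] -/
def WORTopRunPerpetualNonIso (n : ℕ) : Prop :=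
  ∀ p : ℕ, p.Prime → ∀ (k : Type) [Field k] [CharP k p] (Y : Scheme.{0}) (g : Y ⟶ Spec (.of k)),
    IsBase Y g → ∀ M : MarkedIdeal Y, IsDatum n M → TopHeavy Y M.ideal n → TopDeltaHeavy Y M.ideal n →
      TopChainHeavy Y M.ideal n → RunPerpetual n ⟨Y, M.ideal⟩ → RunThreadsNonIsolated n ⟨Y, M.ideal⟩ →
        ∃ t : CentreSeq Y, WeakResolution t M

/-- CELL · RESIDUAL · the complement: some bad thread is ISOLATED in the top locus at infinitely many levels (forced
towers / forced
walks are its extreme; by §4 it contains NO two-chart corner thread of the model).  [OPEN · the habitat of lens-4 /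
lens-5's columns] -/
def WORTopRunPerpetualIso (n : ℕ) : Prop :=
  ∀ p : ℕ, p.Prime → ∀ (k : Type) [Field k] [CharP k p] (Y : Scheme.{0}) (g : Y ⟶ Spec (.of k)),
    IsBase Y g → ∀ M : MarkedIdeal Y, IsDatum n M → TopHeavy Y M.ideal n → TopDeltaHeavy Y M.ideal n →
      TopChainHeavy Y M.ideal n → RunPerpetual n ⟨Y, M.ideal⟩ → ¬ RunThreadsNonIsolated n ⟨Y, M.ideal⟩ →
        ∃ t : CentreSeq Y, WeakResolution t M

/-- **THE EXACT CARVE OF LENS-6's PERPETUAL KIND** (hypothesis-free, excluded middle on the datum kind):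
`WORTopRunPerpetual n ⟺ WORTopRunPerpetualNonIso n ∧ WORTopRunPerpetualIso n`. [new] [folklore] -/
theorem worTopRunPerpetual_iff_nonIso_iso (n : ℕ) :
    WORTopRunPerpetual n ↔ WORTopRunPerpetualNonIso n ∧ WORTopRunPerpetualIso n := by
  constructor
  · intro h
    exact ⟨fun p hp k _ _ Y g hB M hM hT hD hC hP _ => h p hp k Y g hB M hM hT hD hC hP,
      fun p hp k _ _ Y g hB M hM hT hD hC hP _ => h p hp k Y g hB M hM hT hD hC hP⟩
  · rintro ⟨hN, hI⟩ p hp k _ _ Y g hB M hM hT hD hC hP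
    by_cases hk : RunThreadsNonIsolated n ⟨Y, M.ideal⟩
    · exact hN p hp k Y g hB M hM hT hD hC hP hk
    · exact hI p hp k Y g hB M hM hT hD hC hP hk

/-- the aggregate NonIso family over all markings. RESIDUAL (P∞'s). -/
def E1TopRunPerpetualNonIso : Prop := ∀ n : ℕ, 1 ≤ n → WORTopRunPerpetualNonIso n

/-- the aggregate Iso family over all markings. RESIDUAL. -/
def E1TopRunPerpetualIso : Prop := ∀ n : ℕ, 1 ≤ n → WORTopRunPerpetualIso n

/-- **NODE EQUATION** (hypothesis-free): lens-6's kind B splits EXACTLY into the non-isolated (axial) kind and the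
isolated kind: `E1TopRunPerpetual ⟺ E1TopRunPerpetualNonIso ∧ E1TopRunPerpetualIso`. [new] [folklore] -/
theorem node_equation : E1TopRunPerpetual ↔ E1TopRunPerpetualNonIso ∧ E1TopRunPerpetualIso := by
  constructor
  · intro h
    exact ⟨fun n hn => ((worTopRunPerpetual_iff_nonIso_iso n).1 (h n hn)).1,
      fun n hn => ((worTopRunPerpetual_iff_nonIso_iso n).1 (h n hn)).2⟩
  · rintro ⟨hN, hI⟩ n hn
    exact (worTopRunPerpetual_iff_nonIso_iso n).2 ⟨hN n hn, hI n hn⟩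

end Junction

end Summit.ResolutionOfSingularities.ResolutionOfSingularities.Theorems.ThreadCut
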